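import Literature.MathematicalPhysics.QuantumFieldTheory.Balaban1983to89.B9Eq326OperatorTower

/-!
# `Balaban1983to89.B9Eq326LocalPartCoerciveTower` — T. Bałaban, *Propagators for lattice gauge theories in a background field*, Commun. Math. Phys. **99**
# (1985) 389–434 [Balaban1985BackgroundPropagators] (3.26) p. 395, (3.21) p. 394 («R = R(U) is an orthogonal projection … onto the subspace ℛ = Δ^η_U N(Q′)»),
# Thm 3.11 p. 416, with [Balaban1985Variational] (134) p. 298 «(Δ + DRD*)A = (D*D + DD*)A + (Δ′ − DPD*)A», (140) p. 299 «DPD* is a bounded operator»: **THE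
# TOWER LOCAL PART DOMINATES `Δ_{a,k}` — `re⟪x, A₀,k x⟫ = re⟪x, Δ_{a,k}(U)x⟫ + ‖(1 − R_k(U))D*_Ux‖²`, hence positivity and `γ`-coercivity pass from `Δ_{a,k}(U)`
# (Thm 3.11's currency; the OWNER's `exists_coercive_laplaceAk_diagonal_closed`) to `A₀,k = Δ(U) + D_UD*_U + Q_k(U)†(a•Q_k(U))` at every height** — the tower twin
# of the OWNER's one-step `B9Eq326WoodburySchur` §5 (`local_pos_of_pos`, `local_coercive_of_coercive`), by the projection property of `R_k(U)` alone (no `G′_k` side);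
# the `hpos₀`∕`γ` suppliers of ne9-leaf-03 g78's tower local-part rows (EA0S) ∕ (D0TC) ∕ (FCL0)

statement-level skeleton of published theorems with citation tags; proofs where landed; nothing here is a claim about the Yang–Mills mass gap

CITATION HEADER (lean-in-tree rule).  Audit cell `pub-balaban`, sub-cell `t4`, BINDER row NE9; filed by NE9 crux-team LEAF PROVER 03 (`b2b-balaban-t4-ne9-formalise-leaf-03`,
gen 78; road ΔA-CT).  Imports the OWNER's `B9Eq326OperatorTower` only (`laplaceAk`, `RofUk`, `QkW`; through it `B11Eq103H1Complex` (`laplaceAK_apply`,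
`adjoint_covDerivL2K`, `projR`) and Mathlib's `Submodule.starProjection` API).  Source located first-hand in the held text layer
(`paper:balaban1985-cmp99-background-propagators` p. 394 (3.21), p. 395 (3.26)); [Balaban1985Variational] (134), (140) through the OWNER's plan v11 quotations.
[folklore] Hilbert-space algebra; nothing of print's proofs is used.

WHAT IS PROVED (sorry-free; proof lane — 0 `def`; [folklore]).
* `re_inner_self_sub_RofUk_nonneg` (`0 ≤ re⟪s, s − R_k(U)s⟫ = ‖s − R_k s‖²`: `R_k` is an orthogonal projection), **`re_inner_localK_eq_add`**
  (`re⟪x, A₀x⟫ = re⟪x, Δ_{a,k}x⟫ + re⟪D*_Ux, (1 − R_k)D*_Ux⟫`, mutually adjoint transports `hRS`), **`localK_pos_of_pos`**, **`localK_coercive_of_coercive`**.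
HONEST SCOPE.  Algebra only; «NE9 ⇐ the named binders»; NE9 NOT PRINTED ∕ NOT PROVED; row WALLED ON A MODEL (O-NE9-1; #5 UNRULED); spine PROVED 0∕9; rung (B)+1 on a
finite T⁴ — NOT infinite volume, NOT mass gap, NOT BetaPertH, NOT Clay.  NEW file; nothing modified.  Net new unproved facts: 0.
-/

noncomputable section

open scoped InnerProductSpace ComplexConjugate BigOperators

namespace Literature.MathematicalPhysics.QuantumFieldTheory.Balaban1983to89.B9Eq326LocalPartCoerciveTower

open B4Sect5Torus (TSite)
open B9SectCLatticeCarrier (Bond)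
open B9Eq311L2Pairing (WL2)
open B7Prop1Explicit (U1 Wcx boxVec)
open B11Eq103H1Complex (SiteL2K BondL2K covDerivL2K covDivL2K covLaplaceSiteK laplaceAK_apply adjoint_covDerivL2K projR)
open B9Eq310HessianOperator (adTransportW hessOp)
open B9Eq315QTorus (perCfg cornerSite)
open B9Eq315QTower (towerP UlevOf)
open B9Eq326OperatorTower (laplaceAk RofUk QkW QprimeTowerW)

variable {d : ℕ} (L : ℕ) [NeZero L] (m : Fin d → ℕ) [∀ i, NeZero (m i)] (n : ℕ)
  {𝔸 : Type*} [NormedRing 𝔸] [StarRing 𝔸] [NormedAlgebra ℂ 𝔸] [StarModule ℂ 𝔸] [CompleteSpace 𝔸] [NormOneClass 𝔸]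
  {W : Type*} [NormedAddCommGroup W] [InnerProductSpace ℂ W] [FiniteDimensional ℂ W] (φ : W ≃ₗ[ℂ] 𝔸) {c₀ c₁ : ℝ} [Fact (0 < c₀)] [Fact (0 < c₁)]
  (η : ℝ) (U : Bond d (towerP L m (n + 1)) → 𝔸ˣ) (τ : 𝔸 →ₗ[ℂ] ℂ)
  (hRS : ∀ (b : Bond d (towerP L m (n + 1))) (v u : W), ⟪adTransportW φ U b v, u⟫_ℂ = ⟪v, adTransportW φ (fun b => (U b)⁻¹) b u⟫_ℂ)
  (hL : 1 ≤ L) (α : ℕ → ℝ) (hα1 : ∀ j, α j ≤ 1 / 64)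
  (hU1 : ∀ (j : ℕ) (x : B7Prop1Explicit.Site d) (k : Fin d), perCfg (towerP L m (j + 1)) (UlevOf L m (n + 1) U j) x k ∈ U1 𝔸)
  (hreg : ∀ (j : ℕ) (y : TSite d (towerP L m j)) (k : Fin d) (ρ' : Fin d → Fin L),
    ‖((Wcx L (perCfg (towerP L m (j + 1)) (UlevOf L m (n + 1) U j)) (cornerSite L y) k (boxVec L ρ') : 𝔸ˣ) : 𝔸) - 1‖ ≤ α j)
  (a : ℝ)

omit [StarRing 𝔸] [StarModule ℂ 𝔸] [NormOneClass 𝔸] [Fact (0 < c₁)] in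
/-- **`0 ≤ re⟪s, s − R_k(U)s⟫`**: `R_k(U)` is the orthogonal projection onto `Δ_U N(Q′_k(U))`, so `⟪s − Rs, Rs⟫ = 0` and `re⟪s, s − Rs⟫ = ‖s − Rs‖²`.
[folklore] [cite: Balaban1985BackgroundPropagators, (3.21) p.394] -/
theorem re_inner_self_sub_RofUk_nonneg (s : SiteL2K ℂ d (towerP L m (n + 1)) c₀ W) :
    0 ≤ RCLike.re ⟪s, s - RofUk L m n φ η U (c₀ := c₀) s⟫_ℂ := by
  haveI : CompleteSpace ((LinearMap.ker (QprimeTowerW L m n φ U (c₀ := c₀))).map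
      (covLaplaceSiteK ((η : ℂ))⁻¹ (adTransportW φ U) (adTransportW φ fun b => (U b)⁻¹))) := FiniteDimensional.complete ℂ _
  have e : ∀ z, RofUk L m n φ η U (c₀ := c₀) z = ((LinearMap.ker (QprimeTowerW L m n φ U (c₀ := c₀))).map
      (covLaplaceSiteK ((η : ℂ))⁻¹ (adTransportW φ U) (adTransportW φ fun b => (U b)⁻¹))).starProjection z := fun z => by
    unfold RofUk B11Eq103H1Complex.RLatticeK projR; rfl
  set K := (LinearMap.ker (QprimeTowerW L m n φ U (c₀ := c₀))).map
      (covLaplaceSiteK ((η : ℂ))⁻¹ (adTransportW φ U) (adTransportW φ fun b => (U b)⁻¹)) with hK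
  have h0 : ⟪s - K.starProjection s, K.starProjection s⟫_ℂ = 0 :=
    Submodule.starProjection_inner_eq_zero s _ (Submodule.starProjection_apply_mem K s)
  rw [e]
  have hsplit : ⟪s, s - K.starProjection s⟫_ℂ = ⟪s - K.starProjection s, s - K.starProjection s⟫_ℂ + ⟪K.starProjection s, s - K.starProjection s⟫_ℂ := by
    rw [← inner_add_left, sub_add_cancel]
  have h0' : ⟪K.starProjection s, s - K.starProjection s⟫_ℂ = 0 := by rw [← inner_conj_symm, h0, map_zero]
  rw [hsplit, map_add, h0', map_zero, add_zero, inner_self_eq_norm_sq]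
  positivity

include hRS in
/-- **`re⟪x, A₀x⟫ = re⟪x, Δ_{a,k}(U)x⟫ + re⟪D*_Ux, (1 − R_k(U))D*_Ux⟫`** for `A₀ = Δ(U) + D_UD*_U + Q_k(U)†(a•Q_k(U))` — print's (134): `Δ_a = A₀ − D(1 − R)D*`, the
transports mutually adjoint (`D_U† = D*_U`). [cite: Balaban1985BackgroundPropagators, (3.26) p.395, (3.21) p.394; Balaban1985Variational, (134) p.298] -/
theorem re_inner_localK_eq_add
    (A₀ : BondL2K ℂ d (towerP L m (n + 1)) c₀ W →ₗ[ℂ] BondL2K ℂ d (towerP L m (n + 1)) c₀ W)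
    (hA₀ : A₀ = hessOp φ η U τ + covDerivL2K ℂ c₀ ((η : ℂ))⁻¹ (adTransportW φ U) ∘ₗ covDivL2K ℂ c₀ ((η : ℂ))⁻¹ (adTransportW φ fun b => (U b)⁻¹) +
      LinearMap.adjoint (QkW L m n φ U hL α hα1 hU1 hreg (c₀ := c₀) (c₁ := c₁)) ∘ₗ ((a : ℂ) • QkW L m n φ U hL α hα1 hU1 hreg (c₀ := c₀) (c₁ := c₁)))
    (x : BondL2K ℂ d (towerP L m (n + 1)) c₀ W) :
    RCLike.re ⟪x, A₀ x⟫_ℂ = RCLike.re ⟪x, laplaceAk L m n φ η U hL α hα1 hU1 hreg τ (c₀ := c₀) (c₁ := c₁) a x⟫_ℂ +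
      RCLike.re ⟪covDivL2K ℂ c₀ ((η : ℂ))⁻¹ (adTransportW φ fun b => (U b)⁻¹) x,
        covDivL2K ℂ c₀ ((η : ℂ))⁻¹ (adTransportW φ fun b => (U b)⁻¹) x -
          RofUk L m n φ η U (c₀ := c₀) (covDivL2K ℂ c₀ ((η : ℂ))⁻¹ (adTransportW φ fun b => (U b)⁻¹) x)⟫_ℂ := by
  subst hA₀
  have hconj : (starRingEnd ℂ) ((η : ℂ))⁻¹ = ((η : ℂ))⁻¹ := by rw [map_inv₀, Complex.conj_ofReal]
  have hadj := adjoint_covDerivL2K (c₀ := c₀) ((η : ℂ))⁻¹ hconj (adTransportW φ U) (adTransportW φ fun b => (U b)⁻¹) hRS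
  set D := covDerivL2K ℂ c₀ ((η : ℂ))⁻¹ (adTransportW φ U) with hD
  set Ds := covDivL2K ℂ c₀ ((η : ℂ))⁻¹ (adTransportW φ fun b => (U b)⁻¹) with hDs
  have e1 : laplaceAk L m n φ η U hL α hα1 hU1 hreg τ (c₀ := c₀) (c₁ := c₁) a x =
      hessOp φ η U τ x + D (RofUk L m n φ η U (c₀ := c₀) (Ds x)) +
        LinearMap.adjoint (QkW L m n φ U hL α hα1 hU1 hreg (c₀ := c₀) (c₁ := c₁)) ((a : ℂ) • QkW L m n φ U hL α hα1 hU1 hreg (c₀ := c₀) (c₁ := c₁) x) := rfl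
  have e2 : (hessOp φ η U τ + D ∘ₗ Ds +
      LinearMap.adjoint (QkW L m n φ U hL α hα1 hU1 hreg (c₀ := c₀) (c₁ := c₁)) ∘ₗ ((a : ℂ) • QkW L m n φ U hL α hα1 hU1 hreg (c₀ := c₀) (c₁ := c₁)) :
      BondL2K ℂ d (towerP L m (n + 1)) c₀ W →ₗ[ℂ] BondL2K ℂ d (towerP L m (n + 1)) c₀ W) x =
      laplaceAk L m n φ η U hL α hα1 hU1 hreg τ (c₀ := c₀) (c₁ := c₁) a x + D (Ds x - RofUk L m n φ η U (c₀ := c₀) (Ds x)) := by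
    rw [e1, map_sub]
    simp only [LinearMap.add_apply, LinearMap.comp_apply, LinearMap.smul_apply]
    abel
  have e3 : ⟪x, D (Ds x - RofUk L m n φ η U (c₀ := c₀) (Ds x))⟫_ℂ = ⟪Ds x, Ds x - RofUk L m n φ η U (c₀ := c₀) (Ds x)⟫_ℂ := by
    rw [← LinearMap.adjoint_inner_left, hadj]
  rw [e2, inner_add_right, map_add, e3]

include hRS in
/-- **POSITIVITY PASSES TO THE LOCAL PART**: `Δ_{a,k}(U) > 0 ⟹ A₀,k > 0` (the `hpos₀` that defines `A₀,k⁻¹`). [cite: Balaban1985BackgroundPropagators, (3.26) p.395, Thm 3.11 p.416] -/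
theorem localK_pos_of_pos
    (A₀ : BondL2K ℂ d (towerP L m (n + 1)) c₀ W →ₗ[ℂ] BondL2K ℂ d (towerP L m (n + 1)) c₀ W)
    (hA₀ : A₀ = hessOp φ η U τ + covDerivL2K ℂ c₀ ((η : ℂ))⁻¹ (adTransportW φ U) ∘ₗ covDivL2K ℂ c₀ ((η : ℂ))⁻¹ (adTransportW φ fun b => (U b)⁻¹) +
      LinearMap.adjoint (QkW L m n φ U hL α hα1 hU1 hreg (c₀ := c₀) (c₁ := c₁)) ∘ₗ ((a : ℂ) • QkW L m n φ U hL α hα1 hU1 hreg (c₀ := c₀) (c₁ := c₁)))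
    (hpos : ∀ x : BondL2K ℂ d (towerP L m (n + 1)) c₀ W, x ≠ 0 →
      0 < RCLike.re ⟪x, laplaceAk L m n φ η U hL α hα1 hU1 hreg τ (c₀ := c₀) (c₁ := c₁) a x⟫_ℂ)
    (x : BondL2K ℂ d (towerP L m (n + 1)) c₀ W) (hx : x ≠ 0) : 0 < RCLike.re ⟪x, A₀ x⟫_ℂ := by
  rw [re_inner_localK_eq_add L m n φ η U τ hRS hL α hα1 hU1 hreg a A₀ hA₀ x]
  have h := re_inner_self_sub_RofUk_nonneg L m n φ η U (covDivL2K ℂ c₀ ((η : ℂ))⁻¹ (adTransportW φ fun b => (U b)⁻¹) x)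
  linarith [hpos x hx]

include hRS in
/-- **COERCIVITY PASSES TO THE LOCAL PART**: `γ‖x‖² ≤ re⟪x, Δ_{a,k}(U)x⟫ ⟹ γ‖x‖² ≤ re⟪x, A₀,k x⟫` (Thm 3.11's `γ` for `Δ_{a,k}` — e.g. the OWNER's
`exists_coercive_laplaceAk_diagonal_closed` — is a `γ` for the local part). [cite: Balaban1985BackgroundPropagators, (3.26) p.395, Thm 3.11 p.416; Balaban1985Variational, (134), (140) pp.298–299] -/
theorem localK_coercive_of_coercive
    (A₀ : BondL2K ℂ d (towerP L m (n + 1)) c₀ W →ₗ[ℂ] BondL2K ℂ d (towerP L m (n + 1)) c₀ W)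
    (hA₀ : A₀ = hessOp φ η U τ + covDerivL2K ℂ c₀ ((η : ℂ))⁻¹ (adTransportW φ U) ∘ₗ covDivL2K ℂ c₀ ((η : ℂ))⁻¹ (adTransportW φ fun b => (U b)⁻¹) +
      LinearMap.adjoint (QkW L m n φ U hL α hα1 hU1 hreg (c₀ := c₀) (c₁ := c₁)) ∘ₗ ((a : ℂ) • QkW L m n φ U hL α hα1 hU1 hreg (c₀ := c₀) (c₁ := c₁)))
    {γ : ℝ} (hcoer : ∀ x : BondL2K ℂ d (towerP L m (n + 1)) c₀ W,
      γ * ‖x‖ ^ 2 ≤ RCLike.re ⟪x, laplaceAk L m n φ η U hL α hα1 hU1 hreg τ (c₀ := c₀) (c₁ := c₁) a x⟫_ℂ)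
    (x : BondL2K ℂ d (towerP L m (n + 1)) c₀ W) : γ * ‖x‖ ^ 2 ≤ RCLike.re ⟪x, A₀ x⟫_ℂ := by
  rw [re_inner_localK_eq_add L m n φ η U τ hRS hL α hα1 hU1 hreg a A₀ hA₀ x]
  have h := re_inner_self_sub_RofUk_nonneg L m n φ η U (covDivL2K ℂ c₀ ((η : ℂ))⁻¹ (adTransportW φ fun b => (U b)⁻¹) x)
  linarith [hcoer x]

end Literature.MathematicalPhysics.QuantumFieldTheory.Balaban1983to89.B9Eq326LocalPartCoerciveTower

end
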